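import Summits.CriticalPhenomena.PercolationContinuityZ3.Theorems.SahiMasterFamilyPinningAllOrders

/-!
# Conjunctive pinning, every order: domination by the `1`-minor; `C_k` and the pointwise statement inherited from the minor's sub-families

Unit `prim-master-conj` (crux anchor stmt-CriticalPhenomena-4575, helper work), gen 16; memo
`run/shared/lean/prim/prim-l12/prim-master-conj/POINTWISE.md` §17.  Consequences of the identity `Pinning.sahiE_ind_pin_eq` (`…PinningAllOrders`).

Let `U = (C ∩ {e∈ω}, U'_0, …, U'_{m−1})` with `C` an `e`-free increasing event and `U'` increasing events depending on `e` ARBITRARILY; its `1`-minor is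
`(C, U'¹)` (`X¹ = secAt e true X`), its `0`-minor `(∅, U'⁰)` is a zero flag.  Write `E_A` for the functional of the sub-family `(C, (U'¹)_A)`.

* `sahiE_ind_pin_nonneg_and_ge` — **domination**: if `E_{|A|+1}(μ_p; 1_C, 1_{(U'¹)_A}) ≥ 0` for every set of slots `A`, then
  `E_{m+1}(μ_p; 1_U) ≥ p_e · E_{m+1}(μ_p; 1_C, 1_{U'¹}) ≥ 0` (every `p` in the closed cube).  In particular `C_k` passes from the sub-families of the
  `1`-minor to `U`.
* `sahiE_ind_pin_settled` — **the settled class is closed under conjunctive pinning, EVERY ORDER**: if every sub-family `(C, (U'¹)_A)` is settled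
  (`E ≥ 0` and `E = 0 ↔ Z` at every interior parameter), then so is `U`: for interior `p`, `E_{m+1}(μ_p; 1_U) ≥ 0` and `E_{m+1}(μ_p; 1_U) = 0 ↔ U ∈ Z_{m+1}`.
  Mechanism: in the identity every term is `≥ 0` and TRANSFERS its zeros (the minor functionals by settledness + `masterFamilyEqIff_mpr`, the
  coefficients `−E^{σ}` by `sahiE_signedWeight_eq_zero_transfer`), so a zero at one interior point is a zero on the open cube, and (EQI) gives `Z`.
  Gen 15's `settled_of_member_subset_coordEvent` is the case `m + 1 = 3`; this is the all-orders closure operation "(A)_k" asked for in POINTWISE §16,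
  feeding the `k ≤ 7` pipeline (fv / principal-cap / absorbing / ⊗ classes are section-closed, so pinning a member of any of them stays settled).
HONEST FRAMING: closure properties; nothing is asserted about `C_k` / `MasterFamilyEqIff k` in general.  Axioms standard. [this work]
-/

noncomputable section

open scoped Classical

namespace Summit.CriticalPhenomena.PercolationContinuityZ3.Theorems

open Finset Function
open Literature.Combinatorics.Sahi2008
open Literature.Probability.Percolation.DecisionTree (ind ind_of_mem ind_of_not_mem ind_nonneg)

namespace Pinning

variable {ι : Type} [Fintype ι]

omit [Fintype ι] in
/-- The indicator family of a `cons` family of events. [folklore] -/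
theorem ind_vecCons {m : ℕ} (X : Set (Set ι)) (V : Fin m → Set (Set ι)) :
    (fun j => ind (Matrix.vecCons X V j)) = (Matrix.vecCons (ind X) (fun j => ind (V j)) : Fin (m + 1) → Set ι → ℝ) := by
  funext j; refine Fin.cases ?_ (fun j' => ?_) j <;> simp

/-- The `cons`-sub-family indexed by `univ` is the `cons` family. [folklore] -/
theorem sahiE_cons_sub_univ (μ : Set ι → ℝ) {m : ℕ} (f₀ : Set ι → ℝ) (g : Fin m → Set ι → ℝ) :
    sahiE μ ((univ : Finset (Fin m)).card + 1)
        (Matrix.vecCons f₀ (fun j => g ((univ : Finset (Fin m)).orderEmbOfFin rfl j)) : Fin ((univ : Finset (Fin m)).card + 1) → Set ι → ℝ) =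
      sahiE μ (m + 1) (Matrix.vecCons f₀ g : Fin (m + 1) → Set ι → ℝ) := by
  have hc : (univ : Finset (Fin m)).card = m := Finset.card_fin m
  have e1 : (fun j : Fin (univ : Finset (Fin m)).card => g ((univ : Finset (Fin m)).orderEmbOfFin rfl j)) = fun j => g (Fin.cast hc j) := by
    funext j
    have huniq : (fun j : Fin m => j) = ((univ : Finset (Fin m)).orderEmbOfFin hc : Fin m → Fin m) :=
      Finset.orderEmbOfFin_unique hc (fun j => mem_univ j) strictMono_id
    have h1 : (univ : Finset (Fin m)).orderEmbOfFin rfl j = (univ : Finset (Fin m)).orderEmbOfFin hc (Fin.cast hc j) :=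
      Finset.orderEmbOfFin_eq_orderEmbOfFin_iff.mpr rfl
    rw [h1]
    exact congrArg g (congrFun huniq (Fin.cast hc j)).symm
  rw [e1]
  exact sahiE_cons_cast μ hc f₀ g

section Consequences

variable (p : ι → unitInterval) (e : ι) {m : ℕ} (C : Set (Set ι)) (U' : Fin m → Set (Set ι))

/-- **Domination by the `1`-minor and positivity, every order.**  If `C` is `e`-free, the `U'_j` are increasing and every sub-family functional
`E_{|A|+1}(μ_p; 1_C, 1_{(U'¹)_A})` of the `1`-minor is `≥ 0`, then
`p_e · E_{m+1}(μ_p; 1_C, 1_{U'¹}) ≤ E_{m+1}(μ_p; 1_{C∩{e∈ω}}, 1_{U'})` and the latter is `≥ 0`. [this work] -/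
theorem sahiE_ind_pin_nonneg_and_ge (hCe : ∀ b : Bool, secAt e b C = C) (hU' : ∀ j, IsUpperSet (U' j))
    (H : ∀ A : Finset (Fin m), 0 ≤ sahiE (bernoulliWeight p) (A.card + 1)
      (Matrix.vecCons (ind C) (fun j => ind (secAt e true (U' (A.orderEmbOfFin rfl j)))) : Fin (A.card + 1) → Set ι → ℝ)) :
    (p e : ℝ) * sahiE (bernoulliWeight p) (m + 1) (Matrix.vecCons (ind C) (fun j => ind (secAt e true (U' j))) : Fin (m + 1) → Set ι → ℝ) ≤
        sahiE (bernoulliWeight p) (m + 1) (Matrix.vecCons (ind (C ∩ {ω : Set ι | e ∈ ω})) (fun j => ind (U' j)) : Fin (m + 1) → Set ι → ℝ) ∧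
      0 ≤ sahiE (bernoulliWeight p) (m + 1) (Matrix.vecCons (ind (C ∩ {ω : Set ι | e ∈ ω})) (fun j => ind (U' j)) : Fin (m + 1) → Set ι → ℝ) := by
  have ht : 0 ≤ (p e : ℝ) := (p e).2.1
  have hmin : 0 ≤ sahiE (bernoulliWeight p) (m + 1) (Matrix.vecCons (ind C) (fun j => ind (secAt e true (U' j))) : Fin (m + 1) → Set ι → ℝ) := by
    have h := H univ
    rwa [sahiE_cons_sub_univ (bernoulliWeight p) (ind C) (fun j => ind (secAt e true (U' j)))] at h
  have hsum : ∑ A : Finset (Fin m),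
      sahiE (bernoulliWeight p - bernoulliWeight (update p e 1)) A.card (fun j => ind (U' (A.orderEmbOfFin rfl j))) *
        sahiE (bernoulliWeight p) (Aᶜ.card + 1)
          (Matrix.vecCons (ind C) (fun j => ind (secAt e true (U' (Aᶜ.orderEmbOfFin rfl j)))) : Fin (Aᶜ.card + 1) → Set ι → ℝ) ≤ 0 :=
    Finset.sum_nonpos fun A _ => mul_nonpos_of_nonpos_of_nonneg
      (sahiE_signedWeight_nonpos p e (fun j => U' (A.orderEmbOfFin rfl j)) fun j => hU' _) (H Aᶜ)
  rw [sahiE_ind_pin_eq p e m C hCe U']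
  constructor
  · exact mul_le_mul_of_nonneg_left (by linarith) ht
  · exact mul_nonneg ht (by linarith)

/-- **The settled class is closed under conjunctive pinning, every order.**  `p` interior, `C` increasing and `e`-free, `U'_j` increasing; if every
sub-family `(C, (U'¹)_A)` of the `1`-minor is settled on the open cube, then `U = (C ∩ {e∈ω}, U')` is settled at `p`:
`E_{m+1}(μ_p; 1_U) ≥ 0` and `E_{m+1}(μ_p; 1_U) = 0 ↔ U ∈ Z_{m+1}`. [this work] -/
theorem sahiE_ind_pin_settled {p : ι → unitInterval} (hp : ∀ i, (p i : ℝ) ∈ Set.Ioo (0 : ℝ) 1) (e : ι) {m : ℕ} {C : Set (Set ι)}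
    (hCe : ∀ b : Bool, secAt e b C = C) (hC : IsUpperSet C) {U' : Fin m → Set (Set ι)} (hU' : ∀ j, IsUpperSet (U' j))
    (H : ∀ (A : Finset (Fin m)) (r : ι → unitInterval), (∀ i, (r i : ℝ) ∈ Set.Ioo (0 : ℝ) 1) →
      0 ≤ sahiE (bernoulliWeight r) (A.card + 1)
          (Matrix.vecCons (ind C) (fun j => ind (secAt e true (U' (A.orderEmbOfFin rfl j)))) : Fin (A.card + 1) → Set ι → ℝ) ∧
        (sahiE (bernoulliWeight r) (A.card + 1)
            (Matrix.vecCons (ind C) (fun j => ind (secAt e true (U' (A.orderEmbOfFin rfl j)))) : Fin (A.card + 1) → Set ι → ℝ) = 0 ↔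
          SuppZeroFlag (A.card + 1) (Matrix.vecCons C (fun j => secAt e true (U' (A.orderEmbOfFin rfl j))) : Fin (A.card + 1) → Set (Set ι)))) :
    0 ≤ sahiE (bernoulliWeight p) (m + 1) (fun j => ind ((Matrix.vecCons (C ∩ {ω : Set ι | e ∈ ω}) U' : Fin (m + 1) → Set (Set ι)) j)) ∧
      (sahiE (bernoulliWeight p) (m + 1) (fun j => ind ((Matrix.vecCons (C ∩ {ω : Set ι | e ∈ ω}) U' : Fin (m + 1) → Set (Set ι)) j)) = 0 ↔
        SuppZeroFlag (m + 1) (Matrix.vecCons (C ∩ {ω : Set ι | e ∈ ω}) U' : Fin (m + 1) → Set (Set ι))) := by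
  have hUinc : ∀ j, IsUpperSet ((Matrix.vecCons (C ∩ {ω : Set ι | e ∈ ω}) U' : Fin (m + 1) → Set (Set ι)) j) := by
    intro j; refine Fin.cases ?_ (fun j' => ?_) j
    · simpa using hC.inter (Pointwise.isUpperSet_coordEvent e)
    · simpa using hU' j'
  rw [ind_vecCons]
  refine ⟨(sahiE_ind_pin_nonneg_and_ge p e C U' hCe hU' fun A => (H A p hp).1).2, fun hz => ?_, fun hZ => ?_⟩
  · -- a zero at `p` is a zero on the whole open cube
    refine Pointwise.suppZeroFlag_of_eq_zero_on_paramBox _ hUinc (a := fun _ => 0) (b := fun _ => 1) (fun _ => zero_lt_one) (fun _ => le_rfl)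
      (fun _ => le_rfl) fun q _ => ?_
    rw [ind_vecCons]
    -- decompose the zero at `p`
    rw [sahiE_ind_pin_eq p e m C hCe U'] at hz
    have htp : (p e : ℝ) ≠ 0 := ne_of_gt (hp e).1
    have hbr := (mul_eq_zero.mp hz).resolve_left htp
    have hmin : 0 ≤ sahiE (bernoulliWeight p) (m + 1) (Matrix.vecCons (ind C) (fun j => ind (secAt e true (U' j))) : Fin (m + 1) → Set ι → ℝ) := by
      have h := (H univ p hp).1
      rwa [sahiE_cons_sub_univ (bernoulliWeight p) (ind C) (fun j => ind (secAt e true (U' j)))] at h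
    have hnn : ∀ A ∈ (univ : Finset (Finset (Fin m))),
        sahiE (bernoulliWeight p - bernoulliWeight (update p e 1)) A.card (fun j => ind (U' (A.orderEmbOfFin rfl j))) *
          sahiE (bernoulliWeight p) (Aᶜ.card + 1)
            (Matrix.vecCons (ind C) (fun j => ind (secAt e true (U' (Aᶜ.orderEmbOfFin rfl j)))) : Fin (Aᶜ.card + 1) → Set ι → ℝ) ≤ 0 :=
      fun A _ => mul_nonpos_of_nonpos_of_nonneg
        (sahiE_signedWeight_nonpos p e (fun j => U' (A.orderEmbOfFin rfl j)) fun j => hU' _) (H Aᶜ p hp).1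
    have hle := Finset.sum_nonpos hnn
    have hsum_eq : ∑ A : Finset (Fin m),
        sahiE (bernoulliWeight p - bernoulliWeight (update p e 1)) A.card (fun j => ind (U' (A.orderEmbOfFin rfl j))) *
          sahiE (bernoulliWeight p) (Aᶜ.card + 1)
            (Matrix.vecCons (ind C) (fun j => ind (secAt e true (U' (Aᶜ.orderEmbOfFin rfl j)))) : Fin (Aᶜ.card + 1) → Set ι → ℝ) = 0 := by
      linarith
    have hmin0 : sahiE (bernoulliWeight p) (m + 1) (Matrix.vecCons (ind C) (fun j => ind (secAt e true (U' j))) : Fin (m + 1) → Set ι → ℝ) = 0 := by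
      linarith
    have hterm := (Finset.sum_eq_zero_iff_of_nonpos hnn).1 hsum_eq
    -- transfer every piece to `q`
    rw [sahiE_ind_pin_eq q e m C hCe U']
    have hmin0q : sahiE (bernoulliWeight q) (m + 1) (Matrix.vecCons (ind C) (fun j => ind (secAt e true (U' j))) : Fin (m + 1) → Set ι → ℝ) = 0 := by
      have hZ := ((H univ p hp).2).1 (by rwa [sahiE_cons_sub_univ (bernoulliWeight p) (ind C) (fun j => ind (secAt e true (U' j)))])
      have h0 := masterFamilyEqIff_mpr _ ι q _ hZ
      rwa [ind_vecCons, sahiE_cons_sub_univ (bernoulliWeight q) (ind C) (fun j => ind (secAt e true (U' j)))] at h0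
    rw [hmin0q, Finset.sum_eq_zero fun A hA => ?_]
    · ring
    · rcases mul_eq_zero.mp (hterm A hA) with h1 | h1
      · rw [sahiE_signedWeight_eq_zero_transfer hp q e (fun j => U' (A.orderEmbOfFin rfl j)) (fun j => hU' _) h1, zero_mul]
      · have hZ := ((H Aᶜ p hp).2).1 h1
        have h0 := masterFamilyEqIff_mpr _ ι q _ hZ
        rw [ind_vecCons] at h0
        rw [h0, mul_zero]
  · have h0 := masterFamilyEqIff_mpr _ ι p _ hZ
    rwa [ind_vecCons] at h0

/-- **Strict form, every order**: under the hypotheses of `sahiE_ind_pin_settled`, `U ∉ Z_{m+1}` has `E_{m+1}(μ_p; 1_U) > 0` at every interior `p`.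
[this work] -/
theorem sahiE_ind_pin_pos {p : ι → unitInterval} (hp : ∀ i, (p i : ℝ) ∈ Set.Ioo (0 : ℝ) 1) (e : ι) {m : ℕ} {C : Set (Set ι)}
    (hCe : ∀ b : Bool, secAt e b C = C) (hC : IsUpperSet C) {U' : Fin m → Set (Set ι)} (hU' : ∀ j, IsUpperSet (U' j))
    (H : ∀ (A : Finset (Fin m)) (r : ι → unitInterval), (∀ i, (r i : ℝ) ∈ Set.Ioo (0 : ℝ) 1) →
      0 ≤ sahiE (bernoulliWeight r) (A.card + 1)
          (Matrix.vecCons (ind C) (fun j => ind (secAt e true (U' (A.orderEmbOfFin rfl j)))) : Fin (A.card + 1) → Set ι → ℝ) ∧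
        (sahiE (bernoulliWeight r) (A.card + 1)
            (Matrix.vecCons (ind C) (fun j => ind (secAt e true (U' (A.orderEmbOfFin rfl j)))) : Fin (A.card + 1) → Set ι → ℝ) = 0 ↔
          SuppZeroFlag (A.card + 1) (Matrix.vecCons C (fun j => secAt e true (U' (A.orderEmbOfFin rfl j))) : Fin (A.card + 1) → Set (Set ι))))
    (hZ : ¬ SuppZeroFlag (m + 1) (Matrix.vecCons (C ∩ {ω : Set ι | e ∈ ω}) U' : Fin (m + 1) → Set (Set ι))) :
    0 < sahiE (bernoulliWeight p) (m + 1) (fun j => ind ((Matrix.vecCons (C ∩ {ω : Set ι | e ∈ ω}) U' : Fin (m + 1) → Set (Set ι)) j)) := by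
  obtain ⟨h0, hiff⟩ := sahiE_ind_pin_settled hp e hCe hC hU' H
  exact lt_of_le_of_ne h0 fun h => hZ (hiff.1 h.symm)

end Consequences

end Pinning

end Summit.CriticalPhenomena.PercolationContinuityZ3.Theorems
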